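import Literature.NumberTheory.EllipticCurves.PSLineHeight
import Mathlib.NumberTheory.Cyclotomic.Gal
import Mathlib.NumberTheory.Padics.PadicNumbers
import Mathlib.Algebra.Polynomial.SpecificDegree
import HarnessLib

/-!
# The coefficient field `ℚ₃(ζ₃)` of the untwist rows: `Φ₃` is irreducible over `ℚ₃`, the conjugation
# `σ` with `σ(ζ₃) = ζ₃²` exists and inverts every character of order dividing `3` — so the conjugate-line
# symmetry `h_{ψ̄} = σ ∘ h_ψ` of D2 (`PSLineHeightData.conj`) is REALISED over the intended coefficients
# (route `CyclotomicUntwist`, crux K1 `PSRankOneLowerHalfAtThree`)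

Cell `pub/bsd-wall` (D-0145 line `route-BirchSwinnertonDyer-CyclotomicUntwist`), seat `bsd-line-cycu-p1`
(prover seat 1/3), helper toward crux K1 (stmt-BirchSwinnertonDyer-21580). THEOREMS ONLY (no definition, no
named fact, no `sorry`). BSD is not proved by this file and no crux of the route is proved by it.

WHY. D2 (`WeierstrassCurve.PSLineHeightData W R`, intended `R = ℚ₃(ζ₃) = CyclotomicField 3 ℚ_[3]`) carries
the Galois-equivariance axiom `conj : h_{σ∘χ} = σ ∘ h_χ`, and its API (`pairing_inv_eq_of_ringHomComp_eq`,
`pairing_inv_ne_zero_iff_of_ringHomComp_eq`) as well as the typed finite-slope composition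
(`CyclotomicUntwistFiniteSlopeShadowTyped.psRankOne_halves_of_typedFiniteSlope`, cycu-p3) take as a
HYPOTHESIS an automorphism `σ ∈ Aut(R/ℚ₃)` with `σ ∘ ψ = ψ⁻¹`. Over the intended `R` this hypothesis is a
THEOREM, proved here:
* `irreducible_cyclotomic_three_padic` — `Φ₃ = X² + X + 1` is irreducible over `ℚ₃` (a root `z` would give
  `(2z+1)² = −3`, impossible since `‖·‖₃` takes values in `3^ℤ` and `‖−3‖₃ = 3⁻¹`);
* `exists_algEquiv_apply_eq_inv_of_pow_three` — there is `σ : ℚ₃(ζ₃) ≃ₐ[ℚ₃] ℚ₃(ζ₃)` with `σ z = z⁻¹` for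
  every `z` with `z³ = 1` (`σ = fromZetaAut` at `ζ₃²`; Mathlib `IsCyclotomicExtension.fromZetaAut_spec`);
* `exists_algEquiv_ringHomComp_eq_inv` — the same `σ` satisfies `ψ.ringHomComp σ = ψ⁻¹` for EVERY Dirichlet
  character `ψ` (any level) with `ψ³ = 1`, valued in `ℚ₃(ζ₃)`;
* `PSLineHeightData.exists_conj_three` — for a line-height datum over `ℚ₃(ζ₃)` and a line `ψ` (`ψ³ = 1`):
  `h_{ψ⁻¹} = σ ∘ h_ψ` and `h_{ψ⁻¹}(P,Q) ≠ 0 ↔ h_ψ(P,Q) ≠ 0` for a GLOBAL choice of `σ` (the route's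
  "`h_ψ̄ = σ h_ψ`, so Reg_ψ and Reg_ψ̄ vanish together").

References: [cite: Benois2020, §0.3 (Definition p0004:L90; Thm. I–III)] · [cite: PerrinRiou1993AIF, Introduction].
-/

noncomputable section

open Polynomial

-- single-conjunct summit: `Summit.BirchSwinnertonDyer.BirchSwinnertonDyer.…` repeats the name by design
set_option linter.dupNamespace false

namespace Summit.BirchSwinnertonDyer.BirchSwinnertonDyer.Theorems.PSCoefficientField

/-! ### §1 `Φ₃` is irreducible over `ℚ₃` -/

/-- `X² + X + 1` has no root in `ℚ₃`: a root `z` gives `(2z+1)² = −3`, but `‖2z+1‖₃ ∈ 3^ℤ` while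
`‖−3‖₃ = 3⁻¹` is not a square in `3^ℤ`. [folklore] -/
theorem sq_add_self_add_one_ne_zero (z : ℚ_[3]) : z ^ 2 + z + 1 ≠ 0 := by
  intro hz
  have h3 : (2 * z + 1) ^ 2 = -(3 : ℚ_[3]) := by linear_combination 4 * hz
  have hne : 2 * z + 1 ≠ 0 := by
    intro h0
    rw [h0] at h3
    norm_num at h3
  have hnorm : ‖2 * z + 1‖ ^ 2 = (3 : ℝ)⁻¹ := by
    rw [← norm_pow, h3, norm_neg]
    exact_mod_cast Padic.norm_p (p := 3)
  rw [Padic.norm_eq_zpow_neg_valuation hne, ← zpow_natCast, ← zpow_mul] at hnorm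
  have h31 : (3 : ℝ)⁻¹ = (3 : ℝ) ^ (-1 : ℤ) := by norm_num
  push_cast at hnorm
  rw [h31] at hnorm
  have hinj := zpow_right_injective₀ (by norm_num : (0 : ℝ) < 3) (by norm_num : (3 : ℝ) ≠ 1) hnorm
  omega

/-- **The third cyclotomic polynomial is irreducible over `ℚ₃`** (`ℚ₃(ζ₃) = ℚ₃(√−3)` is a ramified
quadratic extension). [folklore] -/
theorem irreducible_cyclotomic_three_padic : Irreducible (cyclotomic 3 ℚ_[3]) := by
  have hmonic : (cyclotomic 3 ℚ_[3]).Monic := cyclotomic.monic 3 ℚ_[3]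
  have hdeg : (cyclotomic 3 ℚ_[3]).natDegree = 2 := by
    rw [natDegree_cyclotomic]; rfl
  refine (hmonic.irreducible_iff_roots_eq_zero_of_degree_le_three (by omega) (by omega)).mpr ?_
  refine Multiset.eq_zero_of_forall_notMem fun z hz ↦ ?_
  rw [mem_roots hmonic.ne_zero, IsRoot.def, cyclotomic_three] at hz
  simp only [eval_add, eval_pow, eval_X, eval_one] at hz
  exact sq_add_self_add_one_ne_zero z hz

/-! ### §2 The conjugation `σ` with `σ(ζ₃) = ζ₃²` inverts every cube root of unity -/

/-- **There is `σ ∈ Aut(ℚ₃(ζ₃)/ℚ₃)` with `σ z = z⁻¹` for every cube root of unity `z`.**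
[folklore] -/
theorem exists_algEquiv_apply_eq_inv_of_pow_three :
    ∃ σ : CyclotomicField 3 ℚ_[3] ≃ₐ[ℚ_[3]] CyclotomicField 3 ℚ_[3],
      ∀ z : CyclotomicField 3 ℚ_[3], z ^ 3 = 1 → σ z = z⁻¹ := by
  set L := CyclotomicField 3 ℚ_[3]
  have hζ : IsPrimitiveRoot (IsCyclotomicExtension.zeta 3 ℚ_[3] L) 3 :=
    IsCyclotomicExtension.zeta_spec 3 ℚ_[3] L
  set ζ := IsCyclotomicExtension.zeta 3 ℚ_[3] L with hζdef
  have hμ : IsPrimitiveRoot (ζ ^ 2) 3 := hζ.pow_of_coprime 2 (by norm_num)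
  refine ⟨IsCyclotomicExtension.fromZetaAut hμ irreducible_cyclotomic_three_padic, fun z hz ↦ ?_⟩
  have hσζ : IsCyclotomicExtension.fromZetaAut hμ irreducible_cyclotomic_three_padic ζ = ζ ^ 2 :=
    IsCyclotomicExtension.fromZetaAut_spec hμ irreducible_cyclotomic_three_padic
  obtain ⟨i, -, rfl⟩ := hζ.eq_pow_of_pow_eq_one hz
  rw [map_pow, hσζ, ← pow_mul]
  -- `ζ^{2i} = (ζ^i)⁻¹` since `ζ^{3i} = 1`
  have h3 : ζ ^ (3 * i) = 1 := by rw [pow_mul, hζ.pow_eq_one, one_pow]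
  exact eq_inv_of_mul_eq_one_left (by rw [← pow_add, show 2 * i + i = 3 * i by ring, h3])

/-- **`σ ∘ ψ = ψ⁻¹` for every character of order dividing `3`**: with `σ` as above and any Dirichlet
character `ψ` (any level `n`) valued in `ℚ₃(ζ₃)` with `ψ³ = 1`, `ψ.ringHomComp σ = ψ⁻¹`.
[cite: Benois2020, §0.3 (Definition p0004:L90)] -/
theorem exists_algEquiv_ringHomComp_eq_inv :
    ∃ σ : CyclotomicField 3 ℚ_[3] ≃ₐ[ℚ_[3]] CyclotomicField 3 ℚ_[3],
      ∀ (n : ℕ) (ψ : DirichletCharacter (CyclotomicField 3 ℚ_[3]) n), ψ ^ 3 = 1 →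
        ψ.ringHomComp (σ : CyclotomicField 3 ℚ_[3] →+* CyclotomicField 3 ℚ_[3]) = ψ⁻¹ := by
  obtain ⟨σ, hσ⟩ := exists_algEquiv_apply_eq_inv_of_pow_three
  refine ⟨σ, fun n ψ hψ ↦ ?_⟩
  ext a
  rw [MulChar.ringHomComp_apply, MulChar.inv_apply_eq_inv']
  have ha : (ψ (a : ZMod n)) ^ 3 = 1 := by
    rw [← MulChar.pow_apply_coe, hψ, MulChar.one_apply_coe]
  exact hσ _ ha

/-! ### §3 Consequence for D2: conjugate lines vanish together over `ℚ₃(ζ₃)` -/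

/-- **Conjugate-line symmetry realised over `ℚ₃(ζ₃)`**: for every line-height datum
`D : PSLineHeightData W (CyclotomicField 3 ℚ_[3])` there is ONE `σ` such that for every line `ψ`
(`ψ³ = 1`) and all points, `h_{ψ⁻¹}(P,Q) = σ(h_ψ(P,Q))`, hence `h_{ψ⁻¹}(P,Q) ≠ 0 ↔ h_ψ(P,Q) ≠ 0` — the
hypothesis "`∃ σ, σ ∘ ψ = ψ⁻¹`" of the typed finite-slope composition is discharged for the intended
coefficient field. [cite: Benois2020, §0.3 (Definition p0004:L90; Thm. I)] [cite: PerrinRiou1993AIF, Introduction] -/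
theorem PSLineHeightData.exists_conj_three (W : WeierstrassCurve ℚ)
    (D : W.PSLineHeightData (CyclotomicField 3 ℚ_[3])) :
    ∃ σ : CyclotomicField 3 ℚ_[3] ≃ₐ[ℚ_[3]] CyclotomicField 3 ℚ_[3],
      ∀ (ψ : DirichletCharacter (CyclotomicField 3 ℚ_[3]) 9), ψ ^ 3 = 1 →
        ψ.ringHomComp (σ : CyclotomicField 3 ℚ_[3] →+* CyclotomicField 3 ℚ_[3]) = ψ⁻¹ ∧
        ∀ P Q : W.toAffine.Point,
          D.pairing ψ⁻¹ P Q = σ (D.pairing ψ P Q) ∧ (D.pairing ψ⁻¹ P Q ≠ 0 ↔ D.pairing ψ P Q ≠ 0) := by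
  obtain ⟨σ, hσ⟩ := exists_algEquiv_ringHomComp_eq_inv
  refine ⟨σ, fun ψ hψ ↦ ⟨hσ 9 ψ hψ, fun P Q ↦ ?_⟩⟩
  exact ⟨D.pairing_inv_eq_of_ringHomComp_eq (hσ 9 ψ hψ) P Q,
    D.pairing_inv_ne_zero_iff_of_ringHomComp_eq (hσ 9 ψ hψ) P Q⟩

end Summit.BirchSwinnertonDyer.BirchSwinnertonDyer.Theorems.PSCoefficientField

end
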